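import Summits.Schanuel.Schanuel.Theorems.RootDecomp1BDefectFloorCells
import Summits.Schanuel.Schanuel.Theorems.RootDecomp1KHyper18

/-!
# RootDecomp1BSRLLogLiouville — part 01: lens 4, generation 29 «SRL LOG-LIOUVILLE COLUMN» — PORT NOTE (census-1 gen 14, 2026-08-31): port of HOME/decomp-schanuel-lens-4/g29/SRLLogLiouvilleColumn.lean (sha256 82cb16982701122b…4525, 650 l; critic VERDICT STATUS L1591 (3) optional PORT GO LOW, census lane) in two parts `RootDecomp1BSRLLogLiouville01`/`02` (cut at §4); the two `set_option linter.*` lines dropped, `liouville_liouvilleNumber_ten` / `liouvilleNumber_ten_pos` / `lambdaH_pos` made private; statements/proofs verbatim; `--supports stmt-Schanuel-32406`; rung 0. The lens's header follows.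

# RootDecomp1B — the SRL LOG-LIOUVILLE COLUMN (lens 4 gen 29; a new DECIDED CELL FAMILY of `SharpRelativeLindemann`, stmt-Schanuel-32406)

Route of record `route-Schanuel-RootDecomp1B` (X = `KleinPolarSchanuel`, stmt-Schanuel-24622), node of record rev 32
(X ⟸ LSB ∧ Free ∧ Tight ∧ SRL ∧ T0 ∧ W0 ∧ NoWildAbsorbingSlackFirstFailure); this file touches ONE leaf, the relative
Lindemann floor `SharpRelativeLindemann` (SRL):

  `SharpRelativeLindemannAt m r  :=  r ℚ-free → KleinIH (m+1) → t(Fin.init r) ≤ 2m → 2m + 1 ≤ t(r)`,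
  `t(r) = polarDeg r = trdeg_ℚ ℚ(r, i r, e^r, e^{i r})`.

DECIDED SO FAR (tree, `RootDecomp1BDefectFloorCells`): the Lindemann–Weierstrass family (β | e^γ) (β, γ real algebraic,
(β, γ) ℚ-free) at every length, and the Nesterenko flag (π | Γ(1/4)).  Recorded first OPEN cells: (1 | π), (π | e^π).

THIS FILE — two cell families (a MODULUS column and its PHASE twin) at EVERY storey `m`:

  **(β | log λ)**, β ∈ (ℚ̄ ∩ ℝ)^m ℚ-free, λ > 0 ANY LIOUVILLE NUMBER (Mathlib `Liouville`; in particular every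
  hyper-Liouville λ of lens 6, e.g. the tree's explicit `λ_H`, and Liouville's constant Σ 10^{-k!} = `liouvilleNumber 10`).

* §1 `algebraicIndependent_option_of_mvPolyMeasure_liouville` — KERNEL (several variables × plain Liouville): a tuple with
  an `MvPolyMeasure` and a Liouville real form an algebraically independent (n+1)-tuple.  The tree had the 1-variable ×
  Liouville kernel (`algebraicIndependent_of_polyMeasure_liouville`, RootDecomp1KHyper02) and the several-variables ×
  HYPER-Liouville kernel (`algebraicIndependent_option_of_mvWeakMeasure_hyperLiouville`, RootDecomp1KHyper18); this is
  their merge (Mahler's argument verbatim: a POLYNOMIAL measure only needs Liouville approximations `q^{-m}`, not `e^{-q^m}`).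
* §2 (E1) λ, e^{y₁}, …, e^{yₙ} algebraically independent for y ∈ ℚ̄ⁿ ℚ-free, λ Liouville (mod `hLW`);
  (E2) `log λ` is TRANSCENDENTAL for every Liouville λ > 0; (E3) (β | log λ) is ℚ-free.
* §3 `floor_snoc_log` : `2m + 1 ≤ t(β | log λ)` outright; `sharpRelativeLindemannAt_snoc_log` : the SRL cell is a
  THEOREM (mod `hLW`); `sharp_init_snoc` : the hyperplane (β) IS sharp; `cell_snoc_log` : all four together;
  `cell_snoc_log_of_hyperLiouville` : the lens-6 class as a special case.
* §4 flagships `(1 | log λ_H)`, `(√2 | log L₁₀)`, `(1, √2 | log λ_H)` (λ_H = `HyperCell.lambdaH`, L₁₀ = `liouvilleNumber 10`).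
* §5 the PHASE twin **(β | arctan λ)** (λ Liouville, fed through e^{iu}: tan u = λ ∈ F): `tan_mem_polarField_snoc`,
  `transcendental_arctan_of_liouville` (via the relation `λ(w²+1) = −i(w²−1)`, w = e^{i arctan λ}), `floor_snoc_arctan`,
  `cell_snoc_arctan`, flagship `(1 | arctan L₁₀)`.
* §6 the COORDINATE column **(β | λ)** (u = λ itself; zeroth member, corollary-grade): `cell_snoc_liouville`, flagship `(√2 | L₁₀)`.

MECHANISM (honest label: the ENGINE is KNOWN — Mahler's class separation «an S-tuple and a U-number are algebraically
independent» [Mahler 1932, J. reine angew. Math. 166; Baker 1975, *Transcendental Number Theory*, Ch. 8, Thm 8.1 and the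
remark following it, p. 82 of the held copy `book:baker1975-transcendental-number-theory`], fed by the Lindemann–Weierstrass
MEASURE `LWMeasure` (Ably 1994; tree-proved in `LindemannWeierstrassMeasureHolds`, carried here as the hypothesis `hLW`
exactly as lens 6 does)):  the 2m + 1 numbers  λ = e^{log λ},  e^{β_j},  e^{iβ_j}  (j < m)  lie in the polar field
F(β | log λ) — λ as the EXPONENTIAL of the last coordinate — and are algebraically independent over ℚ.
What lens 4 adds is the PLACEMENT: a storey-m cell of SRL whose fed datum is the LOGARITHM of a Liouville number —
not supplied by the LW family `floor_snoc_exp` (that needs log(last coordinate) = log log λ ∈ ℚ̄, neither known nor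
expected for any Liouville λ), not by the Nesterenko flag, and not by lens 6's cells (which feed the Liouville datum as
a RATIO ρ = z₁/z₀ of two Schanuel coordinates, `sb_of_hyperLiouville_ratio_of_LW`; the ratios of the polar tuple
(β, log λ, iβ, i log λ) are algebraic, ±i·algebraic, or algebraic·(log λ)^{±1}·{1, ±i} — none Liouville unless
log λ / β_j is, which is not the mechanism here and is not known for any explicit pair).

X AT THESE TUPLES STAYS OPEN for m ≥ 1: `KleinPolarSchanuel (m+1) (β | log λ)` asks `t ≥ 2m + 2`, i.e. that ONE MORE
of log λ, λ^i = e^{i log λ} be algebraically independent of (λ, e^β, e^{iβ}) — an «e ⊥ log»-type statement (m = 1,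
β = 1: trdeg ℚ(e, e^i, λ, log λ, λ^i) ≥ 4), not reachable by any measure in the tree: the cell lies OUTSIDE the regime
where X is known (BC5-style witness).  At m = 0 the cell is the trivial `1 ≤ t(log λ)`.

Nothing here proves Schanuel's conjecture; rung 0.  Sorry-free; standard axioms; imports tree modules only.
-/

noncomputable section

open Complex IntermediateField

namespace Summit.Schanuel.Schanuel.Theorems.RootDecomp1BSRLLogLiouville

open Summit.Schanuel.Schanuel.Theorems.RootDecomp1BFedFlagCore (KleinIH polarDeg baseField polarField
  coe_mem_adjoin_of_mem_span coe_mem_polarField coe_mul_I_mem_polarField exp_coe_mem_polarField exp_coe_mul_I_mem_polarField)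
open Summit.Schanuel.Schanuel.Theorems.RootDecomp1BDefectFloorDefs (SharpRelativeLindemannAt)
open Summit.Schanuel.Schanuel.Theorems.RootDecomp1BDefectFloorCells (polarDeg_le_two_mul_of_algebraic
  isAlgebraic_of_mem_span_algebraic isAlgebraic_polarExp linearIndependent_polar natCast_le_trdeg_of_algebraicIndependent)
open Summit.Schanuel.Schanuel.Theorems.RootDecomp1KHyper (LWMeasure MvPolyMeasure mvPolyMeasure_exp_of_LW mvlen
  transcendental_ofReal_of_liouville
  mvlen_nonneg mvspecialise mvaeval_mvspecialise totalDegree_mvspecialise_le mvlen_mvspecialise_le exists_int_mvrelation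
  exists_ball_eval_ne_zero exists_lipschitz_at_root)
open Summit.Schanuel.Schanuel.Theorems.RootDecomp1KHyper.HyperCell (HyperLiouville lambdaH summable_lambdaH
  hyperLiouville_lambdaH MvWeakMeasure mvaeval_ne_zero_of_mvWeakMeasure algebraicIndependent_of_mvWeakMeasure)

/-! ## §1 KERNEL: a tuple with a polynomial measure and a Liouville real are algebraically independent -/

section Kernel

open Filter Polynomial

/-- **Liouville extraction in several variables (kernel; Mahler's argument).** No relation
`Σ_{k ≤ K} G_k(θ) ℓ^k = 0`, `G_k ∈ ℤ[X₁, …, Xₙ]` not all zero, between a tuple `θ` with an `MvPolyMeasure` and a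
Liouville real `ℓ`: specialise `Y := p/q` at a Liouville approximation of order `m = Kτ + K + 1` with `q` large; the
measure bounds `|q^K P(θ, p/q)|` BELOW by `(C (C_q q^K)^τ)⁻¹`, the Lipschitz estimate ABOVE by `q^K M q^{−m}`.
(Merge of the tree's `no_int_relation_of_polyMeasure_liouville` (one variable) and
`no_int_relation_of_mvWeakMeasure_hyperLiouville` (several variables, hyper-Liouville).) -/
theorem no_int_relation_of_mvPolyMeasure_liouville {n : ℕ} {θ : Fin n → ℂ}
    (hθ : MvPolyMeasure θ) {ℓ : ℝ} (hℓ : Liouville ℓ) {K : ℕ}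
    (G : Fin (K + 1) → MvPolynomial (Fin n) ℤ) (hG : ∃ k, G k ≠ 0)
    (hrel : ∑ k : Fin (K + 1), MvPolynomial.aeval θ (G k) * (ℓ : ℂ) ^ (k : ℕ) = 0) : False := by
  -- the complex polynomial μ(Y) = Σ_k G_k(θ) Y^k
  set μ : ℂ[X] := ∑ k : Fin (K + 1), C (MvPolynomial.aeval θ (G k)) * X ^ (k : ℕ) with hμdef
  have hμeval : ∀ y : ℂ, μ.eval y =
      ∑ k : Fin (K + 1), MvPolynomial.aeval θ (G k) * y ^ (k : ℕ) := by
    intro y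
    simp only [hμdef, eval_finsetSum, eval_mul, eval_C, eval_pow, eval_X]
  have hμcoeff : ∀ k : Fin (K + 1), μ.coeff k = MvPolynomial.aeval θ (G k) := by
    intro k
    simp only [hμdef, finsetSum_coeff, coeff_C_mul, coeff_X_pow]
    rw [Finset.sum_eq_single k]
    · simp
    · intro j _ hjk
      have : (k : ℕ) ≠ (j : ℕ) := fun h => hjk (Fin.ext h).symm
      simp [this]
    · intro h; exact absurd (Finset.mem_univ k) h
  have hμ0 : μ ≠ 0 := by
    obtain ⟨k, hk⟩ := hG
    intro h0
    have h1 : μ.coeff k = 0 := by rw [h0, coeff_zero]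
    rw [hμcoeff] at h1
    exact mvaeval_ne_zero_of_mvWeakMeasure
      (Summit.Schanuel.Schanuel.Theorems.RootDecomp1KHyper.HyperCell.MvPolyMeasure.mvWeakMeasure hθ) hk h1
  have hroot : μ.eval (ℓ : ℂ) = 0 := by rw [hμeval]; exact hrel
  obtain ⟨δ, hδ, hδroot⟩ := exists_ball_eval_ne_zero μ hμ0 ℓ
  obtain ⟨M, hM, hLip⟩ := exists_lipschitz_at_root μ ℓ hroot
  -- sizes
  set D : ℕ := Finset.univ.sup fun k : Fin (K + 1) => (G k).totalDegree with hDdef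
  have hD : ∀ k, (G k).totalDegree ≤ D := fun k =>
    Finset.le_sup (f := fun k : Fin (K + 1) => (G k).totalDegree) (Finset.mem_univ k)
  obtain ⟨Cm, τ, hCm, hmeas⟩ := hθ D
  set Λ : ℤ := ∑ k : Fin (K + 1), mvlen (G k) with hΛ
  have hΛ0 : 0 ≤ Λ := Finset.sum_nonneg fun _ _ => mvlen_nonneg _
  set A : ℕ := ⌈|ℓ|⌉₊ + 2 with hA
  set Cq : ℕ := Λ.toNat * A ^ K + 3 with hCq
  set m : ℕ := K * τ + K + 1 with hm
  set Q₀ : ℝ := Cm * (Cq : ℝ) ^ τ * M + δ⁻¹ + 1 with hQ₀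
  -- a good rational approximation with a large denominator
  obtain ⟨q, ⟨p, hne, hpq⟩, hqQ⟩ :=
    ((hℓ.frequently_exists_num m).and_eventually
      (tendsto_natCast_atTop_atTop.eventually_gt_atTop Q₀)).exists
  have hMCE : 0 ≤ Cm * (Cq : ℝ) ^ τ * M := by positivity
  have hδinv : 0 < δ⁻¹ := inv_pos.mpr hδ
  have hq1 : (1 : ℝ) < q := by
    have : (1 : ℝ) ≤ Q₀ := by rw [hQ₀]; linarith
    linarith
  have hqpos : (0 : ℝ) < q := by linarith
  have hqR : (q : ℝ) ≠ 0 := hqpos.ne'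
  have hq0 : q ≠ 0 := by rintro rfl; simp at hqpos
  have hqinvδ : (q : ℝ)⁻¹ < δ := by
    have h1 : δ⁻¹ < q := by rw [hQ₀] at hqQ; linarith
    exact (inv_lt_comm₀ hδ hqpos).mp h1
  -- r := p/q
  set r : ℝ := (p : ℝ) / q with hr
  have hrℓ : |r - ℓ| < 1 / (q : ℝ) ^ m := by rw [abs_sub_comm]; exact hpq
  have hqm1 : 1 / (q : ℝ) ^ m ≤ (q : ℝ)⁻¹ := by
    rw [one_div]
    exact inv_anti₀ hqpos (le_self_pow₀ hq1.le (by omega))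
  have hrℓ1 : |r - ℓ| ≤ 1 := by
    have : (q : ℝ)⁻¹ ≤ 1 := inv_le_one_of_one_le₀ hq1.le
    linarith
  have hrℓδ : |r - ℓ| < δ := by linarith
  have hrne : r ≠ ℓ := fun h => hne (by rw [← h])
  -- (1) μ(r) ≠ 0
  have hμr : μ.eval (r : ℂ) ≠ 0 := hδroot r hrne hrℓδ
  -- (2) the integer polynomial H = q^K P(X, p/q) and its value at θ
  set H : MvPolynomial (Fin n) ℤ := mvspecialise G p q with hH
  have hrC : ((r : ℝ) : ℂ) = (p : ℂ) / (q : ℂ) := by rw [hr]; push_cast; rfl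
  have hHe : MvPolynomial.aeval θ H = (q : ℂ) ^ K * μ.eval (r : ℂ) := by
    rw [hH, mvaeval_mvspecialise G p hq0 θ, hμeval, hrC]
  have hqC : (q : ℂ) ≠ 0 := by exact_mod_cast hq0
  have hH0 : H ≠ 0 := by
    intro h0
    have : (q : ℂ) ^ K * μ.eval (r : ℂ) = 0 := by rw [← hHe, h0, map_zero]
    rcases mul_eq_zero.mp this with h | h
    · exact pow_ne_zero K hqC h
    · exact hμr h
  -- (3) upper bound
  have hup : ‖MvPolynomial.aeval θ H‖ < (q : ℝ) ^ K * M * (1 / (q : ℝ) ^ m) := by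
    rw [hHe, norm_mul, norm_pow, Complex.norm_natCast]
    calc (q : ℝ) ^ K * ‖μ.eval (r : ℂ)‖ ≤ (q : ℝ) ^ K * (M * |r - ℓ|) := by
          gcongr; exact hLip r hrℓ1
      _ < (q : ℝ) ^ K * (M * (1 / (q : ℝ) ^ m)) := by gcongr
      _ = _ := by ring
  -- (4) the length of H
  have hdegH : H.totalDegree ≤ D := totalDegree_mvspecialise_le G p q hD
  have hpq_bound : (|p| : ℤ) + q ≤ (A : ℤ) * q := by
    have h2 : |(p : ℝ) / q| ≤ |ℓ| + 1 := by
      calc |(p : ℝ) / q| = |(r - ℓ) + ℓ| := by rw [hr]; ring_nf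
        _ ≤ |r - ℓ| + |ℓ| := abs_add_le _ _
        _ ≤ |ℓ| + 1 := by linarith
    rw [abs_div, abs_of_pos hqpos, div_le_iff₀ hqpos] at h2
    have h3 : |ℓ| ≤ ⌈|ℓ|⌉₊ := Nat.le_ceil _
    have h4a : (|ℓ| + 1) * (q : ℝ) ≤ ((⌈|ℓ|⌉₊ : ℝ) + 1) * q :=
      mul_le_mul_of_nonneg_right (by linarith) hqpos.le
    have h4 : |(p : ℝ)| + q ≤ ((⌈|ℓ|⌉₊ : ℝ) + 2) * q := by linarith
    have h5 : (((|p| + q : ℤ)) : ℝ) ≤ (((A : ℤ) * q : ℤ) : ℝ) := by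
      rw [hA]; push_cast; linarith
    exact_mod_cast h5
  have hpq0 : (0 : ℤ) ≤ |p| + q := by positivity
  have hlenH : mvlen H ≤ ((Cq * q ^ K : ℕ) : ℤ) := by
    calc mvlen H ≤ (|p| + q) ^ K * Λ := mvlen_mvspecialise_le G p q
      _ ≤ ((A : ℤ) * q) ^ K * Λ := by gcongr
      _ = (A : ℤ) ^ K * (q : ℤ) ^ K * Λ := by ring
      _ ≤ (A : ℤ) ^ K * (q : ℤ) ^ K * Λ.toNat + 3 * (q : ℤ) ^ K := by
          have h1 : Λ ≤ Λ.toNat := Int.self_le_toNat Λ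
          have h2 : (0 : ℤ) ≤ (A : ℤ) ^ K * (q : ℤ) ^ K := by positivity
          have h3 : (0 : ℤ) ≤ 3 * (q : ℤ) ^ K := by positivity
          exact le_add_of_le_of_nonneg (mul_le_mul_of_nonneg_left h1 h2) h3
      _ = ((Cq * q ^ K : ℕ) : ℤ) := by rw [hCq]; push_cast; ring
  have hlenR : ((mvlen H : ℤ) : ℝ) ≤ (Cq : ℝ) * (q : ℝ) ^ K := by
    have h1 : (((mvlen H : ℤ)) : ℝ) ≤ (((Cq * q ^ K : ℕ) : ℤ) : ℝ) := by exact_mod_cast hlenH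
    have h2 : (((Cq * q ^ K : ℕ) : ℤ) : ℝ) = (Cq : ℝ) * (q : ℝ) ^ K := by push_cast; ring
    rw [← h2]; exact h1
  have hlen0 : (0 : ℝ) ≤ ((mvlen H : ℤ) : ℝ) := by exact_mod_cast mvlen_nonneg H
  -- (5) the lower bound of the measure, (6) the clash
  have hlow : 1 ≤ Cm * ((mvlen H : ℤ) : ℝ) ^ τ * ‖MvPolynomial.aeval θ H‖ := hmeas H hH0 hdegH
  have hlow' : (1 : ℝ) ≤ Cm * ((Cq : ℝ) * (q : ℝ) ^ K) ^ τ * ‖MvPolynomial.aeval θ H‖ := by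
    calc (1 : ℝ) ≤ Cm * ((mvlen H : ℤ) : ℝ) ^ τ * ‖MvPolynomial.aeval θ H‖ := hlow
      _ ≤ Cm * ((Cq : ℝ) * (q : ℝ) ^ K) ^ τ * ‖MvPolynomial.aeval θ H‖ := by gcongr
  have hchain : (1 : ℝ) <
      Cm * ((Cq : ℝ) * (q : ℝ) ^ K) ^ τ * ((q : ℝ) ^ K * M * (1 / (q : ℝ) ^ m)) :=
    calc (1 : ℝ) ≤ Cm * ((Cq : ℝ) * (q : ℝ) ^ K) ^ τ * ‖MvPolynomial.aeval θ H‖ := hlow'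
      _ < Cm * ((Cq : ℝ) * (q : ℝ) ^ K) ^ τ * ((q : ℝ) ^ K * M * (1 / (q : ℝ) ^ m)) := by gcongr
  have hqm : (q : ℝ) ^ m = (q : ℝ) ^ (K * τ) * (q : ℝ) ^ K * q := by rw [hm]; ring
  have heq : Cm * ((Cq : ℝ) * (q : ℝ) ^ K) ^ τ * ((q : ℝ) ^ K * M * (1 / (q : ℝ) ^ m))
      = Cm * (Cq : ℝ) ^ τ * M / q := by
    rw [hqm, mul_pow, ← pow_mul]
    field_simp
  rw [heq, lt_div_iff₀ hqpos, one_mul] at hchain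
  have : (q : ℝ) < Q₀ := by rw [hQ₀]; linarith
  linarith

/-- **Mahler's class principle in several variables (kernel).** A tuple `θ` with an `MvPolyMeasure` and a Liouville
real `ℓ` form an algebraically independent `(n+1)`-tuple `(ℓ, θ₁, …, θₙ)`.  [Mahler 1932: U-numbers are algebraically
independent of S-tuples; Baker 1975 Ch. 8.] -/
theorem algebraicIndependent_option_of_mvPolyMeasure_liouville {n : ℕ} {θ : Fin n → ℂ}
    (hθ : MvPolyMeasure θ) {ℓ : ℝ} (hℓ : Liouville ℓ) :
    AlgebraicIndependent ℚ (fun o : Option (Fin n) => o.elim (ℓ : ℂ) θ) := by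
  have hθi := algebraicIndependent_of_mvWeakMeasure
    (Summit.Schanuel.Schanuel.Theorems.RootDecomp1KHyper.HyperCell.MvPolyMeasure.mvWeakMeasure hθ)
  rw [hθi.option_iff_transcendental]
  intro halg
  obtain ⟨K, G, hGK, hrel⟩ := exists_int_mvrelation halg
  exact no_int_relation_of_mvPolyMeasure_liouville hθ hℓ G ⟨Fin.last K, hGK⟩ hrel

end Kernel

section

variable {m : ℕ}

/-! ## §2 The engine on the LW exponentials -/

/-- **(E1)** For `y₁, …, yₙ ∈ ℚ̄` ℚ-linearly independent and `λ` Liouville, the `n + 1` numbers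
`λ, e^{y₁}, …, e^{yₙ}` are algebraically independent over ℚ (mod `hLW`). -/
theorem algebraicIndependent_option_exp_of_LW (hLW : LWMeasure) {n : ℕ} {y : Fin n → ℂ}
    (hy : ∀ i, IsAlgebraic ℚ (y i)) (hli : LinearIndependent ℚ y) {l : ℝ} (hl : Liouville l) :
    AlgebraicIndependent ℚ (fun o : Option (Fin n) => o.elim ((l : ℝ) : ℂ) (fun i => cexp (y i))) :=
  algebraicIndependent_option_of_mvPolyMeasure_liouville (mvPolyMeasure_exp_of_LW hLW hy hli) hl

/-- **(E2)** `log λ` is TRANSCENDENTAL for every Liouville `λ > 0` (mod `hLW`): were it algebraic (it is `≠ 0`, `λ`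
being irrational), (E1) at `n = 1`, `y = (log λ)` would make `(λ, e^{log λ}) = (λ, λ)` algebraically independent. -/
theorem transcendental_log_of_liouville (hLW : LWMeasure) {l : ℝ} (hl : Liouville l) (hl0 : 0 < l) :
    Transcendental ℚ ((Real.log l : ℝ) : ℂ) := by
  intro halg
  have hne : Real.log l ≠ 0 := Real.log_ne_zero_of_pos_of_ne_one hl0 hl.irrational.ne_one
  have hy : ∀ i : Fin 1, IsAlgebraic ℚ ((![((Real.log l : ℝ) : ℂ)] : Fin 1 → ℂ) i) := fun i => by
    fin_cases i; exact halg
  have hli : LinearIndependent ℚ (![((Real.log l : ℝ) : ℂ)] : Fin 1 → ℂ) :=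
    linearIndependent_unique_iff.mpr (by simpa using hne)
  have hai := algebraicIndependent_option_exp_of_LW hLW hy hli hl
  have h : (none : Option (Fin 1)) = some 0 := hai.injective (by
    show ((l : ℝ) : ℂ) = cexp ((![((Real.log l : ℝ) : ℂ)] : Fin 1 → ℂ) 0)
    rw [Matrix.cons_val_zero, ← Complex.ofReal_exp, Real.exp_log hl0])
  exact Option.some_ne_none 0 h.symm

/-- **(E3)** `(β | log λ)` is ℚ-FREE for β algebraic ℚ-free: `span_ℚ(β) ⊂ ℚ̄` misses the transcendental `log λ`. -/
theorem linearIndependent_snoc_log (hLW : LWMeasure) (β : Fin m → ℝ) (hβ : ∀ j, IsAlgebraic ℚ ((β j : ℝ) : ℂ))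
    (hli : LinearIndependent ℚ β) {l : ℝ} (hl : Liouville l) (hl0 : 0 < l) :
    LinearIndependent ℚ (Fin.snoc β (Real.log l) : Fin (m + 1) → ℝ) :=
  linearIndependent_finSnoc.mpr
    ⟨hli, fun hmem => transcendental_log_of_liouville hLW hl hl0 (isAlgebraic_of_mem_span_algebraic β hβ hmem)⟩

/-! ## §3 The floor on the column (β | log λ) -/

/-- the exponentials `e^{β_j}`, `e^{iβ_j}` of the hyperplane coordinates lie in the polar field of `(β | u)`. -/
theorem exp_polarExp_mem_polarField_snoc (β : Fin m → ℝ) (u : ℝ) (i : Fin (m + m)) :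
    cexp (Fin.append (fun j => ((β j : ℝ) : ℂ)) (fun j => ((β j : ℝ) : ℂ) * Complex.I) i) ∈
      polarField (Fin.snoc β u : Fin (m + 1) → ℝ) := by
  induction i using Fin.addCases with
  | left j =>
    simpa only [Fin.append_left, Fin.snoc_castSucc] using
      exp_coe_mem_polarField (Fin.snoc β u : Fin (m + 1) → ℝ) (Fin.castSucc j)
  | right j =>
    simpa only [Fin.append_right, Fin.snoc_castSucc] using
      exp_coe_mul_I_mem_polarField (Fin.snoc β u : Fin (m + 1) → ℝ) (Fin.castSucc j)

/-- `λ = e^{log λ}` lies in the polar field of `(β | log λ)` — as the EXPONENTIAL of the last coordinate. -/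
theorem coe_mem_polarField_snoc_log (β : Fin m → ℝ) {l : ℝ} (hl0 : 0 < l) :
    ((l : ℝ) : ℂ) ∈ polarField (Fin.snoc β (Real.log l) : Fin (m + 1) → ℝ) := by
  have h := exp_coe_mem_polarField (Fin.snoc β (Real.log l) : Fin (m + 1) → ℝ) (Fin.last m)
  rw [Fin.snoc_last, ← Complex.ofReal_exp, Real.exp_log hl0] at h
  exact h

/-- **THE FLOOR IS DECIDED ON THE LOG-LIOUVILLE COLUMN, at every length**: for β₁, …, β_m real algebraic ℚ-free and
λ > 0 Liouville, `t(β | log λ) ≥ 2m + 1` — the `2m + 1` numbers λ, e^{β_j}, e^{iβ_j} lie in F(β | log λ) and are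
algebraically independent over ℚ (E1).  X at the same tuple («t ≥ 2m + 2») is OPEN for m ≥ 1. -/
theorem floor_snoc_log (hLW : LWMeasure) (β : Fin m → ℝ) (hβ : ∀ j, IsAlgebraic ℚ ((β j : ℝ) : ℂ))
    (hli : LinearIndependent ℚ β) {l : ℝ} (hl : Liouville l) (hl0 : 0 < l) :
    ((m + m + 1 : ℕ) : Cardinal) ≤ polarDeg (Fin.snoc β (Real.log l) : Fin (m + 1) → ℝ) := by
  have hai := algebraicIndependent_option_exp_of_LW hLW (isAlgebraic_polarExp β hβ)
    (linearIndependent_polar hli) hl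
  have hmem : ∀ o : Option (Fin (m + m)),
      o.elim ((l : ℝ) : ℂ)
          (fun i => cexp (Fin.append (fun j => ((β j : ℝ) : ℂ)) (fun j => ((β j : ℝ) : ℂ) * Complex.I) i)) ∈
        polarField (Fin.snoc β (Real.log l) : Fin (m + 1) → ℝ) := by
    rintro (_ | i)
    · exact coe_mem_polarField_snoc_log β hl0
    · exact exp_polarExp_mem_polarField_snoc β (Real.log l) i
  exact natCast_le_trdeg_of_algebraicIndependent (hai.comp _ (finSuccEquiv (m + m)).injective)
    (fun k => hmem (finSuccEquiv (m + m) k))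

/-- **THE CELL `SharpRelativeLindemannAt m (β | log λ)` IS A THEOREM** (mod `hLW`), λ > 0 any Liouville number. -/
theorem sharpRelativeLindemannAt_snoc_log (hLW : LWMeasure) (β : Fin m → ℝ)
    (hβ : ∀ j, IsAlgebraic ℚ ((β j : ℝ) : ℂ)) (hli : LinearIndependent ℚ β) {l : ℝ} (hl : Liouville l)
    (hl0 : 0 < l) : SharpRelativeLindemannAt m (Fin.snoc β (Real.log l) : Fin (m + 1) → ℝ) :=
  fun _ _ _ => floor_snoc_log hLW β hβ hli hl hl0

/-- … its hyperplane (β) IS sharp: `t(β) ≤ 2m` … -/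
theorem sharp_init_snoc (β : Fin m → ℝ) (hβ : ∀ j, IsAlgebraic ℚ ((β j : ℝ) : ℂ)) (u : ℝ) :
    polarDeg (Fin.init (Fin.snoc β u : Fin (m + 1) → ℝ)) ≤ ((m + m : ℕ) : Cardinal) := by
  rw [Fin.init_snoc]
  exact polarDeg_le_two_mul_of_algebraic β hβ

/-- … so on the column the floor holds with ALL its structural hypotheses discharged: ℚ-free (E3), sharp hyperplane,
the conclusion `2m + 1 ≤ t`, and the SRL instance (which needs neither `KleinIH` nor the hyperplane bound). -/
theorem cell_snoc_log (hLW : LWMeasure) (β : Fin m → ℝ) (hβ : ∀ j, IsAlgebraic ℚ ((β j : ℝ) : ℂ))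
    (hli : LinearIndependent ℚ β) {l : ℝ} (hl : Liouville l) (hl0 : 0 < l) :
    LinearIndependent ℚ (Fin.snoc β (Real.log l) : Fin (m + 1) → ℝ) ∧
      polarDeg (Fin.init (Fin.snoc β (Real.log l) : Fin (m + 1) → ℝ)) ≤ ((m + m : ℕ) : Cardinal) ∧
      ((m + m + 1 : ℕ) : Cardinal) ≤ polarDeg (Fin.snoc β (Real.log l) : Fin (m + 1) → ℝ) ∧
      SharpRelativeLindemannAt m (Fin.snoc β (Real.log l) : Fin (m + 1) → ℝ) :=
  ⟨linearIndependent_snoc_log hLW β hβ hli hl hl0, sharp_init_snoc β hβ _, floor_snoc_log hLW β hβ hli hl hl0,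
    sharpRelativeLindemannAt_snoc_log hLW β hβ hli hl hl0⟩

/-- The lens-6 class as a special case: every HYPER-Liouville λ > 0. -/
theorem cell_snoc_log_of_hyperLiouville (hLW : LWMeasure) (β : Fin m → ℝ)
    (hβ : ∀ j, IsAlgebraic ℚ ((β j : ℝ) : ℂ)) (hli : LinearIndependent ℚ β) {l : ℝ} (hl : HyperLiouville l)
    (hl0 : 0 < l) :
    LinearIndependent ℚ (Fin.snoc β (Real.log l) : Fin (m + 1) → ℝ) ∧
      polarDeg (Fin.init (Fin.snoc β (Real.log l) : Fin (m + 1) → ℝ)) ≤ ((m + m : ℕ) : Cardinal) ∧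
      ((m + m + 1 : ℕ) : Cardinal) ≤ polarDeg (Fin.snoc β (Real.log l) : Fin (m + 1) → ℝ) ∧
      SharpRelativeLindemannAt m (Fin.snoc β (Real.log l) : Fin (m + 1) → ℝ) :=
  cell_snoc_log hLW β hβ hli hl.liouville hl0

end

end Summit.Schanuel.Schanuel.Theorems.RootDecomp1BSRLLogLiouville
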